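import Summits.Ventures.PercRepro.C041FiveExitCount
import Summits.Ventures.PercRepro.C041TwoExitSix

/-!
# ROW C-041 — THE FIVE-EXIT ATTACHMENT: the fibre vector and the six-vector as the sum of the fibre vectors (p6,
gen 31; r = 5, step (5))

`fibVec5 ω` = the six fibre counts of `glue5` over a colouring `ω` of `Z₁` (`C041FiveExitCount`), and
**`sixVec_eq_sum_fibVec5`**: `Π(glue5) = ∑_ω fibVec5 ω` (through `stateEquiv5` and `card_filter_prod_eq_sum`).
The contribution `contrib5` and the identification are the generators' (gen4main.py generalised).
-/

namespace PercRepro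

namespace ZoneZ

namespace TwoExit

open ZoneData TreeClosure Finset

variable {V₁ E₁ U₁ U₂ V E T₁ T₂ V' E' T₁' T₂' V'' E'' T₁'' T₂'' V''' E''' T₁''' T₂''' V'''' E'''' T₁'''' T₂'''' : Type}
variable (Z₁ : ZoneData V₁ E₁ U₁ U₂) (u u' u'' u''' u'''' : V₁) (Z : ZoneData V E T₁ T₂) (a : V)
  (Z' : ZoneData V' E' T₁' T₂') (a' : V') (Z'' : ZoneData V'' E'' T₁'' T₂'') (a'' : V'')
  (Z''' : ZoneData V''' E''' T₁''' T₂''') (a''' : V''') (Z'''' : ZoneData V'''' E'''' T₁'''' T₂'''') (a'''' : V'''')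
  (a₁ : V₁)
variable [Fintype E₁] [DecidableEq E₁] [Fintype E] [DecidableEq E] [Fintype T₁] [DecidableEq T₁]
  [Fintype T₂] [DecidableEq T₂] [Fintype E'] [DecidableEq E'] [Fintype T₁'] [DecidableEq T₁']
  [Fintype T₂'] [DecidableEq T₂'] [Fintype E''] [DecidableEq E''] [Fintype T₁''] [DecidableEq T₁'']
  [Fintype T₂''] [DecidableEq T₂''] [Fintype E'''] [DecidableEq E'''] [Fintype T₁'''] [DecidableEq T₁''']
  [Fintype T₂'''] [DecidableEq T₂'''] [Fintype E''''] [DecidableEq E''''] [Fintype T₁''''] [DecidableEq T₁'''']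
  [Fintype T₂''''] [DecidableEq T₂'''']

/-- The six fibre counts over a colouring `ω` of `Z₁`. -/
noncomputable def fibVec5 (ω : E₁ → Bool) : Vec6 :=
  ![(#(fib5 Z₁ u u' u'' u''' u'''' Z a Z' a' Z'' a'' Z''' a''' Z'''' a'''' a₁ ω true true false) : ℝ),
    #(fib5 Z₁ u u' u'' u''' u'''' Z a Z' a' Z'' a'' Z''' a''' Z'''' a'''' a₁ ω false true false),
    #(fib5 Z₁ u u' u'' u''' u'''' Z a Z' a' Z'' a'' Z''' a''' Z'''' a'''' a₁ ω true false false),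
    #(fib5 Z₁ u u' u'' u''' u'''' Z a Z' a' Z'' a'' Z''' a''' Z'''' a'''' a₁ ω true true true),
    #(fib5 Z₁ u u' u'' u''' u'''' Z a Z' a' Z'' a'' Z''' a''' Z'''' a'''' a₁ ω false true true),
    #(fib5 Z₁ u u' u'' u''' u'''' Z a Z' a' Z'' a'' Z''' a''' Z'''' a'''' a₁ ω true false true)]

set_option synthInstance.maxSize 2048 in
/-- A filter on the states of the attachment, as a filter on quintuples. -/
theorem card_filter_eq5 (Q : State (((((E₁ ⊕ E') ⊕ E) ⊕ E'') ⊕ E''') ⊕ E'''') ((((T₁' ⊕ T₁) ⊕ T₁'') ⊕ T₁''') ⊕ T₁'''')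
      ((((T₂' ⊕ T₂) ⊕ T₂'') ⊕ T₂''') ⊕ T₂'''') → Prop)
    (Q' : (E₁ → Bool) × State E' T₁' T₂' × State E T₁ T₂ × State E'' T₁'' T₂'' × State E''' T₁''' T₂''' ×
      State E'''' T₁'''' T₂'''' → Prop) [DecidablePred Q]
    [DecidablePred Q'] (h : ∀ σ, Q σ ↔ Q' (col₁₅ σ, st'₅ σ, st₅ σ, st''₅ σ, st'''₅ σ, st''''₅ σ)) :
    #(univ.filter Q) = #(univ.filter Q') := by
  refine Finset.card_equiv (stateEquiv5 (E₁ := E₁) (E := E) (T₁ := T₁) (T₂ := T₂) (E' := E') (T₁' := T₁')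
    (T₂' := T₂') (E'' := E'') (T₁'' := T₁'') (T₂'' := T₂'') (E''' := E''') (T₁''' := T₁''') (T₂''' := T₂''')
    (E'''' := E'''') (T₁'''' := T₁'''') (T₂'''' := T₂'''')) fun σ => ?_
  rw [Finset.mem_filter, Finset.mem_filter]
  simp only [Finset.mem_univ, true_and, stateEquiv5_apply]
  exact h σ

omit [Fintype E₁] [DecidableEq E₁] in
/-- A fibre is the filter of its condition on triples (with any decidability instance). -/
theorem fib5_eq_filter (ω : E₁ → Bool) (c1 c2 k : Bool)
    [DecidablePred fun p : State E' T₁' T₂' × State E T₁ T₂ × State E'' T₁'' T₂'' × State E''' T₁''' T₂''' ×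
      State E'''' T₁'''' T₂'''' =>
      fibCond5 Z₁ u u' u'' u''' u'''' Z a Z' a' Z'' a'' Z''' a''' Z'''' a'''' a₁ ω c1 c2 k p.1 p.2.1 p.2.2.1 p.2.2.2.1
        p.2.2.2.2] :
    fib5 Z₁ u u' u'' u''' u'''' Z a Z' a' Z'' a'' Z''' a''' Z'''' a'''' a₁ ω c1 c2 k =
      univ.filter fun p : State E' T₁' T₂' × State E T₁ T₂ × State E'' T₁'' T₂'' × State E''' T₁''' T₂''' ×
      State E'''' T₁'''' T₂'''' =>
        fibCond5 Z₁ u u' u'' u''' u'''' Z a Z' a' Z'' a'' Z''' a''' Z'''' a'''' a₁ ω c1 c2 k p.1 p.2.1 p.2.2.1 p.2.2.2.1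
        p.2.2.2.2 := by
  ext p
  rw [mem_fib5, Finset.mem_filter]
  exact (and_iff_right (Finset.mem_univ _)).symm

set_option synthInstance.maxSize 2048 in
/-- One count of the attachment, as the sum over the colourings of the fibre counts. -/
theorem card_eq_sum_card_fib5 (S : Finset (State (((((E₁ ⊕ E') ⊕ E) ⊕ E'') ⊕ E''') ⊕ E'''') ((((T₁' ⊕ T₁) ⊕ T₁'') ⊕ T₁''') ⊕ T₁'''')
      ((((T₂' ⊕ T₂) ⊕ T₂'') ⊕ T₂''') ⊕ T₂'''')))
    (c1 c2 k : Bool)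
    (h : ∀ σ, σ ∈ S ↔ fibCond5 Z₁ u u' u'' u''' u'''' Z a Z' a' Z'' a'' Z''' a''' Z'''' a'''' a₁ (col₁₅ σ) c1 c2 k (st'₅ σ) (st₅ σ) (st''₅ σ) (st'''₅ σ)
        (st''''₅ σ)) :
    #S = ∑ ω : E₁ → Bool, #(fib5 Z₁ u u' u'' u''' u'''' Z a Z' a' Z'' a'' Z''' a''' Z'''' a'''' a₁ ω c1 c2 k) := by
  classical
  have e : S = univ.filter fun σ =>
      fibCond5 Z₁ u u' u'' u''' u'''' Z a Z' a' Z'' a'' Z''' a''' Z'''' a'''' a₁ (col₁₅ σ) c1 c2 k (st'₅ σ) (st₅ σ) (st''₅ σ) (st'''₅ σ)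
        (st''''₅ σ) := by
    ext σ
    rw [h, Finset.mem_filter]
    exact (and_iff_right (Finset.mem_univ _)).symm
  rw [e, card_filter_eq5 _ (fun p : (E₁ → Bool) × State E' T₁' T₂' × State E T₁ T₂ × State E'' T₁'' T₂'' × State E''' T₁''' T₂''' ×
      State E'''' T₁'''' T₂'''' =>
    fibCond5 Z₁ u u' u'' u''' u'''' Z a Z' a' Z'' a'' Z''' a''' Z'''' a'''' a₁ p.1 c1 c2 k p.2.1 p.2.2.1 p.2.2.2.1 p.2.2.2.2.1
      p.2.2.2.2.2) (fun _ => Iff.rfl),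
    card_filter_prod_eq_sum]
  refine Finset.sum_congr rfl fun ω _ => ?_
  rw [fib5_eq_filter]

set_option synthInstance.maxSize 2048 in
/-- **The six-vector of the four-exit attachment is the sum of the fibre vectors.** -/
theorem sixVec_eq_sum_fibVec5 :
    (glue5 Z₁ u u' u'' u''' u'''' Z a Z' a' Z'' a'' Z''' a''' Z'''' a'''').sixVec
      (Sum.inl (Sum.inl (Sum.inl (Sum.inl (Sum.inl a₁))))) =
      ∑ ω : E₁ → Bool, fibVec5 Z₁ u u' u'' u''' u'''' Z a Z' a' Z'' a'' Z''' a''' Z'''' a'''' a₁ ω := by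
  refine vec6_ext _ _ ?_ ?_ ?_ ?_ ?_ ?_
  · rw [Finset.sum_apply, sixVec_zero,
      card_eq_sum_card_fib5 Z₁ u u' u'' u''' u'''' Z a Z' a' Z'' a'' Z''' a''' Z'''' a'''' a₁ _ true true false
        (mem_Fset_iff5 Z₁ u u' u'' u''' u'''' Z a Z' a' Z'' a'' Z''' a''' Z'''' a'''' a₁)]
    push_cast
    simp only [fibVec5, Matrix.cons_val]
  · rw [Finset.sum_apply, sixVec_one,
      card_eq_sum_card_fib5 Z₁ u u' u'' u''' u'''' Z a Z' a' Z'' a'' Z''' a''' Z'''' a'''' a₁ _ false true false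
        (mem_FAset_iff5 Z₁ u u' u'' u''' u'''' Z a Z' a' Z'' a'' Z''' a''' Z'''' a'''' a₁)]
    push_cast
    simp only [fibVec5, Matrix.cons_val]
  · rw [Finset.sum_apply, sixVec_two,
      card_eq_sum_card_fib5 Z₁ u u' u'' u''' u'''' Z a Z' a' Z'' a'' Z''' a''' Z'''' a'''' a₁ _ true false false
        (mem_FBset_iff5 Z₁ u u' u'' u''' u'''' Z a Z' a' Z'' a'' Z''' a''' Z'''' a'''' a₁)]
    push_cast
    simp only [fibVec5, Matrix.cons_val]
  · rw [Finset.sum_apply, sixVec_three,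
      card_eq_sum_card_fib5 Z₁ u u' u'' u''' u'''' Z a Z' a' Z'' a'' Z''' a''' Z'''' a'''' a₁ _ true true true
        (mem_IFset_iff5 Z₁ u u' u'' u''' u'''' Z a Z' a' Z'' a'' Z''' a''' Z'''' a'''' a₁)]
    push_cast
    simp only [fibVec5, Matrix.cons_val]
  · rw [Finset.sum_apply, sixVec_four,
      card_eq_sum_card_fib5 Z₁ u u' u'' u''' u'''' Z a Z' a' Z'' a'' Z''' a''' Z'''' a'''' a₁ _ false true true
        (mem_IAset_iff5 Z₁ u u' u'' u''' u'''' Z a Z' a' Z'' a'' Z''' a''' Z'''' a'''' a₁)]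
    push_cast
    simp only [fibVec5, Matrix.cons_val]
  · rw [Finset.sum_apply, sixVec_five,
      card_eq_sum_card_fib5 Z₁ u u' u'' u''' u'''' Z a Z' a' Z'' a'' Z''' a''' Z'''' a'''' a₁ _ true false true
        (mem_IBset_iff5 Z₁ u u' u'' u''' u'''' Z a Z' a' Z'' a'' Z''' a''' Z'''' a'''' a₁)]
    push_cast
    simp only [fibVec5, Matrix.cons_val]

end TwoExit

end ZoneZ

end PercRepro
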